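import Summits.SmoothPoincare4.SmoothPoincare4.Theorems.ConvexBisectionAcyclicBisectionExistsSeamShadowTransport
import Summits.SmoothPoincare4.SmoothPoincare4.Theorems.ConvexBisectionAcyclicBisectionExistsSeamExtendedPage
import Summits.SmoothPoincare4.SmoothPoincare4.Theorems.ConvexBisectionAcyclicBisectionExistsPageInvarianceTwisting
import Literature.Geometry.Symplectic.TwoHandleIsotopyFraming
import HarnessLib

/-!
# Seam transport, ST5: node T3c-2 `node_seam_transport` from the twisting-sign statement ST4
(wave 4, sub-node ST5 of node T3c-2 `node_seam_transport` of stub `stub_steinRealisation` = NF6, line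
`modp-braid-orbits` r11, crux `ConvexBisection.AcyclicBisectionExists`, item stmt-SmoothPoincare4-10508;
registered sub-goal `helper_isFramingAlong_ambient`; the contract `node_seam_transport_of_twistSign`
rides along — its statement exceeds the registration limit)

The node text `node_seam_transport` of the design file `T3_DualHandles_Design.lean` (l. 544–575; the
text consumed VERBATIM by Z7's landed `node_dualLink_pageLink_of_universal_nodes`) is PROVED here from
its last open sub-node, the twisting-sign statement ST4 (`node_ST4_twistSign` of
`T3c2_SeamTransport_Design.lean`), taken as the hypothesis `H4` AT THE DATA; the other sub-nodes are
landed: ST1 `seam_extendedPage` (the pushed framed knots are framed knots of `∂ Base g` in the extended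
pages), ST2 `helper_strFlow_page` (the radial straightening isotopy), ST3 `seam_shadowTransport` (the
shadow automorphisms `A_c`).  §0 is the plumbing: an ambient isotopy of `Base g` preserving `rho` moves a
framed knot of `∂ Base g` as an isotopy of knots in the boundary (`knotIsotopyOfAmbient`) carrying the
framing by the differentials of its stages (`isFramingAlong_ambient`, `IsKnotFraming.pushforward` +
`continuous_mfderiv_ambientIsotopy_bundle`), and a uniform margin for finitely many positive continuous
functions on the circle (`exists_margin`).  So the lead's `node_seam_transport g l h hlink D bX Ψ hpage`
is `node_seam_transport_of_twistSign D bX Ψ hlink hpage (ST4 at the data)`.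

Everything is proved; no named facts, no `sorry`; one definition (`knotIsotopyOfAmbient`, a
`KnotIsotopyInBoundary` built from an ambient isotopy).  References: R. İ. Baykur, *Kähler decomposition
of 4-manifolds*, AGT 6 (2006), proof of Thm. 5.1 [Baykur2006]; J. B. Etnyre, T. Fuller, IMRN 2006, Thm. 1
(proof, p. 8) [EtnyreFuller2006]; M. W. Hirsch, *Differential Topology* (1976), §8.1 [Hirsch1976];
A. Kosinski, *Differential Manifolds* (1993), III (2.7)–(2.8) [Kosinski1993].
-/

noncomputable section

set_option linter.dupNamespace false

open scoped Manifold ContDiff Topology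

namespace Summit.SmoothPoincare4.SmoothPoincare4.Theorems.AcyclicBisectionExists.ModpBraidOrbits

open Set Function Filter Metric Topology Bundle
open Literature.Topology.FourManifolds Literature.Topology.FourManifolds.HandleAttachingMap
  Literature.Topology.FourManifolds.BoundaryManifold Literature.Topology.FourManifolds.LefschetzBase
  Literature.Geometry.Symplectic

/-! ## §0 Plumbing: framed boundary knots moved by an ambient isotopy of the base -/

section Plumbing

variable {g : ℕ}

/-- **A knot in `∂ Base g` moved by an ambient isotopy of `Base g` is an isotopy of knots in the
boundary**, provided the isotopy preserves the levels of `rho` (so boundary points stay boundary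
points; every flow of a field tangent to the `rho`-levels does, `baseIsotopy`). [cite: Hirsch1976, §8.1] -/
def knotIsotopyOfAmbient (R : AmbientIsotopy (𝓡∂ 4) (Base g))
    (hR : ∀ (t : ℝ) (x : Base g), rho g (R.toFun t x).1 = rho g x.1)
    {k : sphere (0 : EuclideanSpace ℝ (Fin 2)) 1 → Base g} (hk : IsBoundaryKnot k) :
    KnotIsotopyInBoundary k (R.toFun 1 ∘ k) where
  toFun t := R.toFun t ∘ k
  contMDiff := R.contMDiff.comp (contMDiff_fst.prodMk (hk.isSmoothEmbedding.contMDiff.comp contMDiff_snd))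
  isSmoothEmbedding t := hk.isSmoothEmbedding.diffeomorph_comp (R.toDiffeomorph t)
  map_zero := by
    funext u
    show R.toFun 0 (k u) = k u
    rw [R.map_zero]
    rfl
  map_one := rfl
  isBoundaryPoint t _ u := by
    show R.toFun t (k u) ∈ (𝓡∂ 4).boundary (Base g)
    rw [RegularSublevel.mem_boundary_iff (isRegularLevel_rho g)]
    have hb : k u ∈ (𝓡∂ 4).boundary (Base g) := hk.isBoundaryPoint u
    rw [RegularSublevel.mem_boundary_iff (isRegularLevel_rho g)] at hb
    exact (hR t (k u)).trans hb

/-- Stages of the moved knot. [folklore] -/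
@[simp] theorem knotIsotopyOfAmbient_toFun (R : AmbientIsotopy (𝓡∂ 4) (Base g))
    (hR : ∀ (t : ℝ) (x : Base g), rho g (R.toFun t x).1 = rho g x.1)
    {k : sphere (0 : EuclideanSpace ℝ (Fin 2)) 1 → Base g} (hk : IsBoundaryKnot k) (t : ℝ) :
    (knotIsotopyOfAmbient R hR hk).toFun t = R.toFun t ∘ k := rfl

/-- **The differentials of the stages carry a framing along the moved knot**: every stage is a
framing (`IsKnotFraming.pushforward` by the stage diffeomorphism) and the family is continuous into
the tangent bundle (`continuous_mfderiv_ambientIsotopy_bundle`). [cite: Kosinski1993, III (2.7)–(2.8)] -/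
theorem isFramingAlong_ambient (R : AmbientIsotopy (𝓡∂ 4) (Base g))
    (hR : ∀ (t : ℝ) (x : Base g), rho g (R.toFun t x).1 = rho g x.1)
    {k : sphere (0 : EuclideanSpace ℝ (Fin 2)) 1 → Base g} (hk : IsBoundaryKnot k)
    {μ : sphere (0 : EuclideanSpace ℝ (Fin 2)) 1 → EuclideanSpace ℝ (Fin 4)} (hμ : IsKnotFraming k μ) :
    IsFramingAlong (knotIsotopyOfAmbient R hR hk) μ
      fun t u => mfderiv (𝓡∂ 4) (𝓡∂ 4) (R.toFun t) (k u) (μ u) where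
  apply_zero := by
    funext u
    show mfderiv (𝓡∂ 4) (𝓡∂ 4) (R.toFun 0) (k u) (μ u) = μ u
    rw [R.map_zero, mfderiv_id]
    rfl
  isKnotFraming t _ := hμ.pushforward hk (R.toDiffeomorph t)
  continuousOn := (continuous_mfderiv_ambientIsotopy_bundle R hμ.continuous).continuousOn

/-- The end framing of the moved family is homotopic to itself (it IS a framing of the end knot).
[folklore] -/
theorem framingHomotopic_ambient_end (R : AmbientIsotopy (𝓡∂ 4) (Base g))
    {k : sphere (0 : EuclideanSpace ℝ (Fin 2)) 1 → Base g} (hk : IsBoundaryKnot k)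
    {μ : sphere (0 : EuclideanSpace ℝ (Fin 2)) 1 → EuclideanSpace ℝ (Fin 4)} (hμ : IsKnotFraming k μ) :
    FramingHomotopic (R.toFun 1 ∘ k) (fun u => mfderiv (𝓡∂ 4) (𝓡∂ 4) (R.toFun 1) (k u) (μ u))
      fun u => mfderiv (𝓡∂ 4) (𝓡∂ 4) (R.toFun 1) (k u) (μ u) :=
  FramingHomotopic.refl (hk.comp_diffeomorph (R.toDiffeomorph 1)) (hμ.pushforward hk (R.toDiffeomorph 1))

/-- **A uniform positive lower bound** for finitely many continuous positive functions on the
circle (compactness). [folklore] -/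
theorem exists_margin {ι : Type} [Finite ι] (f : ι → sphere (0 : EuclideanSpace ℝ (Fin 2)) 1 → ℝ)
    (hf : ∀ i, Continuous (f i)) (hpos : ∀ i θ, 0 < f i θ) :
    ∃ m : ℝ, 0 < m ∧ ∀ i θ, m ≤ f i θ := by
  classical
  have hmin : ∀ i, ∃ θ₀, ∀ θ, f i θ₀ ≤ f i θ := fun i => by
    obtain ⟨θ₀, -, h⟩ := isCompact_univ.exists_isMinOn ⟨circlePt 0, mem_univ _⟩ (hf i).continuousOn
    exact ⟨θ₀, fun θ => h (mem_univ θ)⟩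
  choose θ₀ hθ₀ using hmin
  rcases isEmpty_or_nonempty ι with hι | hι
  · exact ⟨1, one_pos, fun i => (IsEmpty.false i).elim⟩
  · obtain ⟨i₀, hi₀⟩ := Finite.exists_min fun i => f i (θ₀ i)
    exact ⟨f i₀ (θ₀ i₀), hpos _ _, fun i θ => (hi₀ i).trans (hθ₀ i θ)⟩

end Plumbing

/-- **Sub-goal `helper_isFramingAlong_ambient` of stub `stub_steinRealisation`** (NF6 ▸ T3 ▸ T3c-2 ▸ ST5;
wave 4, lead c5): an ambient isotopy `R` of `Base g` preserving `rho` carries a framing `μ` of a knot `k`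
of `∂ Base g` along the isotopy of knots `t ↦ R_t ∘ k` (`knotIsotopyOfAmbient`) as the family
`dR_t (μ)`, and the end framing `dR_1 (μ)` is a framing of `R_1 ∘ k` (homotopic to itself).
[cite: Kosinski1993, III (2.7)–(2.8)] -/
theorem helper_isFramingAlong_ambient : ∀ (g : ℕ) (R : Literature.Topology.FourManifolds.AmbientIsotopy (𝓡∂ 4) (Literature.Topology.FourManifolds.LefschetzBase.Base g)) (hR : ∀ (t : ℝ) (x : Literature.Topology.FourManifolds.LefschetzBase.Base g), Literature.Topology.FourManifolds.LefschetzBase.rho g (R.toFun t x).1 = Literature.Topology.FourManifolds.LefschetzBase.rho g x.1) (k : Metric.sphere (0 : EuclideanSpace ℝ (Fin 2)) 1 → Literature.Topology.FourManifolds.LefschetzBase.Base g) (hk : Literature.Geometry.Symplectic.IsBoundaryKnot k) (μ : Metric.sphere (0 : EuclideanSpace ℝ (Fin 2)) 1 → EuclideanSpace ℝ (Fin 4)), Literature.Geometry.Symplectic.IsKnotFraming k μ → Literature.Geometry.Symplectic.IsFramingAlong (Summit.SmoothPoincare4.SmoothPoincare4.Theorems.AcyclicBisectionExists.ModpBraidOrbits.knotIsotopyOfAmbient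 R hR hk) μ (fun t u => mfderiv (𝓡∂ 4) (𝓡∂ 4) (R.toFun t) (k u) (μ u)) ∧ Literature.Geometry.Symplectic.FramingHomotopic (R.toFun 1 ∘ k) (fun u => mfderiv (𝓡∂ 4) (𝓡∂ 4) (R.toFun 1) (k u) (μ u)) (fun u => mfderiv (𝓡∂ 4) (𝓡∂ 4) (R.toFun 1) (k u) (μ u)) :=
  fun _ R hR _ hk _ hμ => ⟨isFramingAlong_ambient R hR hk hμ, framingHomotopic_ambient_end R hk hμ⟩

/-! ## §1 The node from the twisting-sign statement -/

section Assembly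

variable {g : ℕ} {l : List ((Fin g ⊕ Fin g → ℤ) × Bool)}
  {h : Fin l.length → HandleAttachingMap 3 2 (Base g)}
  {X : Type} [TopologicalSpace X] [T2Space X] [SecondCountableTopology X] [CompactSpace X]
  [ChartedSpace (EuclideanHalfSpace 4) X] [IsManifold (𝓡∂ 4) ∞ X]
  (D : MultiAttachmentData h (𝓡∂ 4) X) (bX : BoundaryData (𝓡∂ 4) X (𝓡 3))
  (Ψ : bX.carrier ≃ₘ⟮𝓡 3, 𝓡 3⟯ (bBase g).carrier)

/-- **NODE T3c-2 (`node_seam_transport`) FROM THE TWISTING-SIGN STATEMENT ST4** (the contract of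
sub-node ST5 of `T3c2_SeamTransport_Design.lean`, checked by the kernel).  Hypotheses: a Lefschetz
link `h` of word `l`, `X = Base g ∪_{h̄} (handles)` (data `D`), a boundary datum `bX`, the seam `Ψ`,
the page clause, and `H4` = ST4 at the data: a global sign `s₀ = ±1` such that for every framed page
knot off the cores with lifts `z, u` and EVERY fibred ambient isotopy `R` of `Base g` (preserving `rho`
and the direction of `w`) flattening the pushed knot into its page, the straightened pushed framed knot
has page twisting `s₀ ·` that of the knot.  Conclusion: the node text verbatim — for every finite
family of framed page knots at distinct directions, off the cores, with lifts: automorphisms `A i`,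
straightened knots `K' i ⊂ page (c i)` with framings `ν' i`, a link isotopy in `∂ Base g` from the pushed
knots carrying the pushed framings, shadows `A i (shadow (K i))`, twistings `s₀ · pageTwisting (K i) (ν i)`.
Proof: ST1 (`seam_extendedPage`) + margin (`exists_margin`) + ST2 (`helper_strFlow_page`) + the ambient
isotopy applied to the pushed link (`knotIsotopyOfAmbient`, `isFramingAlong_ambient`; components
disjoint by injectivity of `R_t`, `(bBase g).incl`, `Ψ`, `bX.incl`, `jA` and `disjoint_page`) +
`shadow_comp_ambientIsotopy` + ST3 (`seam_shadowTransport`) + `H4`.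
[cite: Baykur2006, Thm. 5.1 (proof, p. 13); EtnyreFuller2006, Thm. 1 (proof, p. 8)] -/
theorem node_seam_transport_of_twistSign (hlink : IsLefschetzLink g l h)
    (hpage : ∀ (y : bX.carrier) (a : ↥(coresComplement h)), bX.incl y = D.jA a →
      ∃ c : ℝ, 0 < c ∧ w g ((bBase g).incl (Ψ y)).1 = (c : ℂ) * w g (a : Base g).1)
    (H4 : ∃ s₀ : ℤ, (s₀ = 1 ∨ s₀ = -1) ∧
      ∀ (c : ℂ) (_ : ‖c‖ = 1) (K : sphere (0 : EuclideanSpace ℝ (Fin 2)) 1 → Base g)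
        (ν : sphere (0 : EuclideanSpace ℝ (Fin 2)) 1 → EuclideanSpace ℝ (Fin 4))
        (hK : ∀ θ, K θ ∈ coresComplement h) (_ : ∀ θ, K θ ∈ page g c)
        (_ : IsBoundaryKnot K) (_ : IsKnotFraming K ν)
        (z : sphere (0 : EuclideanSpace ℝ (Fin 2)) 1 → bX.carrier)
        (_ : ∀ θ, bX.incl (z θ) = D.jA ⟨K θ, hK θ⟩)
        (u : sphere (0 : EuclideanSpace ℝ (Fin 2)) 1 → EuclideanSpace ℝ (Fin 3))
        (_ : ∀ θ, mfderiv (𝓡 3) (𝓡∂ 4) bX.incl (z θ) (u θ) =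
          mfderiv (𝓡∂ 4) (𝓡∂ 4) (fun a : ↥(coresComplement h) => D.jA a) ⟨K θ, hK θ⟩ (ν θ))
        (R : AmbientIsotopy (𝓡∂ 4) (Base g))
        (_ : ∀ (t : ℝ) (x : Base g), rho g (R.toFun t x).1 = rho g x.1)
        (_ : ∀ (t : ℝ) (x : Base g), ∃ r : ℝ, 0 < r ∧ w g (R.toFun t x).1 = (r : ℂ) * w g x.1)
        (_ : ∀ θ, R.toFun 1 ((bBase g).incl (Ψ (z θ))) ∈ page g c),
        pageTwisting g (R.toFun 1 ∘ fun θ => ((bBase g).incl (Ψ (z θ)) : Base g))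
            (fun θ => mfderiv (𝓡∂ 4) (𝓡∂ 4) (R.toFun 1) ((bBase g).incl (Ψ (z θ)))
              (mfderiv (𝓡 3) (𝓡∂ 4) (fun y => ((bBase g).incl (Ψ y) : Base g)) (z θ) (u θ))) =
          s₀ * pageTwisting g K ν) :
    ∃ s₀ : ℤ, (s₀ = 1 ∨ s₀ = -1) ∧
      ∀ (ι : Type) [Finite ι] (c : ι → ℂ) (_ : ∀ i, ‖c i‖ = 1) (_ : Injective c)
        (K : ι → sphere (0 : EuclideanSpace ℝ (Fin 2)) 1 → Base g)
        (ν : ι → sphere (0 : EuclideanSpace ℝ (Fin 2)) 1 → EuclideanSpace ℝ (Fin 4))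
        (hKc : ∀ i, Continuous (K i)) (hK : ∀ i θ, K i θ ∈ coresComplement h)
        (_ : ∀ i θ, K i θ ∈ page g (c i)) (_ : ∀ i, IsBoundaryKnot (K i))
        (_ : ∀ i, IsKnotFraming (K i) (ν i))
        (z : ι → sphere (0 : EuclideanSpace ℝ (Fin 2)) 1 → bX.carrier)
        (_ : ∀ i θ, bX.incl (z i θ) = D.jA ⟨K i θ, hK i θ⟩)
        (u : ι → sphere (0 : EuclideanSpace ℝ (Fin 2)) 1 → EuclideanSpace ℝ (Fin 3))
        (_ : ∀ i θ, mfderiv (𝓡 3) (𝓡∂ 4) bX.incl (z i θ) (u i θ) =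
          mfderiv (𝓡∂ 4) (𝓡∂ 4) (fun a : ↥(coresComplement h) => D.jA a) ⟨K i θ, hK i θ⟩ (ν i θ)),
        ∃ (A : ι → ((Fin g ⊕ Fin g → ℤ) ≃ₗ[ℤ] (Fin g ⊕ Fin g → ℤ)))
          (K' : ι → sphere (0 : EuclideanSpace ℝ (Fin 2)) 1 → Base g)
          (ν' : ι → sphere (0 : EuclideanSpace ℝ (Fin 2)) 1 → EuclideanSpace ℝ (Fin 4))
          (hK'c : ∀ i, Continuous (K' i))
          (Φ : LinkIsotopyInBoundary (fun i θ => ((bBase g).incl (Ψ (z i θ)) : Base g)) K')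
          (νt : ι → ℝ → sphere (0 : EuclideanSpace ℝ (Fin 2)) 1 → EuclideanSpace ℝ (Fin 4)),
          (∀ i θ, K' i θ ∈ page g (c i)) ∧ (∀ i, IsKnotFraming (K' i) (ν' i)) ∧
          (∀ i, shadow g (K' i) (hK'c i) = A i (shadow g (K i) (hKc i))) ∧
          (∀ i, pageTwisting g (K' i) (ν' i) = s₀ * pageTwisting g (K i) (ν i)) ∧
          (∀ i, IsFramingAlong (Φ.isotopy i)
            (fun θ => mfderiv (𝓡 3) (𝓡∂ 4) (fun y => ((bBase g).incl (Ψ y) : Base g)) (z i θ) (u i θ))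
            (νt i)) ∧
          (∀ i, FramingHomotopic (K' i) (νt i 1) (ν' i)) := by
  obtain ⟨s₀, hs₀, hST4⟩ := H4
  refine ⟨s₀, hs₀, ?_⟩
  intro ι _ c hc hcinj K ν hKc hK hKp hKb hKν z hz u hu
  -- ST1: the pushed framed knots are framed knots of `∂ Base g` in the extended pages
  have hST1 := fun i => seam_extendedPage D bX Ψ hpage (c i) (K i) (ν i) (hK i) (hKp i) (hKb i)
    (hKν i) (z i) (hz i) (u i) (hu i)
  have hkb : ∀ i, IsBoundaryKnot (fun θ => ((bBase g).incl (Ψ (z i θ)) : Base g)) := fun i => (hST1 i).1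
  have hkμ : ∀ i, IsKnotFraming (fun θ => ((bBase g).incl (Ψ (z i θ)) : Base g))
      (fun θ => mfderiv (𝓡 3) (𝓡∂ 4) (fun y => ((bBase g).incl (Ψ y) : Base g)) (z i θ) (u i θ)) :=
    fun i => (hST1 i).2.1
  have hkρ : ∀ i θ, rho g ((bBase g).incl (Ψ (z i θ)) : Base g).1 = 1 / 4 := fun i => (hST1 i).2.2.1
  have hkw : ∀ i θ, ∃ r : ℝ, 0 < r ∧ w g ((bBase g).incl (Ψ (z i θ)) : Base g).1 = (r : ℂ) * c i :=
    fun i => (hST1 i).2.2.2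
  have hkc : ∀ i, Continuous (fun θ => ((bBase g).incl (Ψ (z i θ)) : Base g)) := fun i =>
    (hkb i).isSmoothEmbedding.contMDiff.continuous
  -- the margin `m`: `‖w‖ ≥ m` on all pushed knots
  obtain ⟨m, hm0, hmw⟩ : ∃ m : ℝ, 0 < m ∧ ∀ i θ, m ≤ ‖w g ((bBase g).incl (Ψ (z i θ)) : Base g).1‖ := by
    refine exists_margin (fun i θ => ‖w g ((bBase g).incl (Ψ (z i θ)) : Base g).1‖) (fun i => ?_)
      (fun i θ => ?_)
    · exact ((contDiff_w g).continuous.comp (continuous_subtype_val.comp (hkc i))).norm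
    · obtain ⟨r, hr, hrw⟩ := hkw i θ
      show 0 < ‖w g ((bBase g).incl (Ψ (z i θ)) : Base g).1‖
      rw [hrw, norm_mul, Complex.norm_real, Real.norm_eq_abs, abs_of_pos hr, hc i, mul_one]
      exact hr
  -- ST2: the straightening isotopy at margin `m`
  obtain ⟨R, θf, -, -, -, hRθ, hρθ, hdirθ, -, -, -, -, -, -, hflat⟩ := helper_strFlow_page g m hm0
  have hRρ : ∀ (t : ℝ) (x : Base g), rho g (R.toFun t x).1 = rho g x.1 := fun t x => by
    rw [hRθ, hρθ]
  have hRdir : ∀ (t : ℝ) (x : Base g), ∃ r : ℝ, 0 < r ∧ w g (R.toFun t x).1 = (r : ℂ) * w g x.1 :=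
    fun t x => by rw [hRθ]; exact hdirθ t x.1
  have hK'p : ∀ i θ, R.toFun 1 ((bBase g).incl (Ψ (z i θ))) ∈ page g (c i) := fun i θ =>
    hflat _ (c i) (hc i) (hkρ i θ) (hmw i θ) (hkw i θ)
  -- ST3: the automorphisms `A i := A_{c i}`
  have hA3 := fun i => seam_shadowTransport D bX Ψ hlink hpage (hc i)
  choose A hA using hA3
  -- the link isotopy: components stay pairwise disjoint
  have hdisj : ∀ t : ℝ, Pairwise fun i j =>
      Disjoint (range (R.toFun t ∘ fun θ => ((bBase g).incl (Ψ (z i θ)) : Base g)))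
        (range (R.toFun t ∘ fun θ => ((bBase g).incl (Ψ (z j θ)) : Base g))) := by
    intro t i j hij
    rw [Set.disjoint_left]
    rintro x ⟨θ, rfl⟩ ⟨θ', hθ'⟩
    have h1 : ((bBase g).incl (Ψ (z j θ')) : Base g) = (bBase g).incl (Ψ (z i θ)) :=
      (R.bijective t).1 hθ'
    have h2 : z j θ' = z i θ := Ψ.injective ((bBase g).injective_incl h1)
    have h3 : D.jA ⟨K j θ', hK j θ'⟩ = D.jA ⟨K i θ, hK i θ⟩ := by rw [← hz, ← hz, h2]
    have h4 : K j θ' = K i θ := congrArg Subtype.val (D.hjA.isEmbedding.injective h3)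
    have h5 : K i θ ∈ page g (c j) := h4 ▸ hKp j θ'
    by_cases hcc : c i = c j
    · exact hij (hcinj hcc)
    · exact Set.disjoint_left.1 (disjoint_page g hcc) (hKp i θ) h5
  -- the outputs
  refine ⟨A, fun i => R.toFun 1 ∘ fun θ => ((bBase g).incl (Ψ (z i θ)) : Base g),
    fun i θ => mfderiv (𝓡∂ 4) (𝓡∂ 4) (R.toFun 1) ((bBase g).incl (Ψ (z i θ)))
      (mfderiv (𝓡 3) (𝓡∂ 4) (fun y => ((bBase g).incl (Ψ y) : Base g)) (z i θ) (u i θ)),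
    fun i => (R.contMDiff_toFun 1).continuous.comp (hkc i),
    ⟨fun i => knotIsotopyOfAmbient R hRρ (hkb i), fun t _ => hdisj t⟩,
    fun i t θ => mfderiv (𝓡∂ 4) (𝓡∂ 4) (R.toFun t) ((bBase g).incl (Ψ (z i θ)))
      (mfderiv (𝓡 3) (𝓡∂ 4) (fun y => ((bBase g).incl (Ψ y) : Base g)) (z i θ) (u i θ)),
    fun i θ => hK'p i θ, fun i => (hkμ i).pushforward (hkb i) (R.toDiffeomorph 1), fun i => ?_,
    fun i => ?_, fun i => isFramingAlong_ambient R hRρ (hkb i) (hkμ i),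
    fun i => framingHomotopic_ambient_end R (hkb i) (hkμ i)⟩
  · -- shadows: invariance along the ambient isotopy, then ST3
    rw [shadow_comp_ambientIsotopy R 1 (hkc i)]
    exact hA i (K i) (hKc i) (hK i) (hKp i) (z i) (hz i) (hkc i)
  · -- twisting: ST4
    exact hST4 (c i) (hc i) (K i) (ν i) (hK i) (hKp i) (hKb i) (hKν i) (z i) (hz i) (u i) (hu i) R
      hRρ hRdir (hK'p i)


end Assembly

end Summit.SmoothPoincare4.SmoothPoincare4.Theorems.AcyclicBisectionExists.ModpBraidOrbits

end
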